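import Summits.ResolutionOfSingularities.ResolutionOfSingularities.Theorems.EquisingularLiftEquisingularLiftBlowupModelLargeChar
import Summits.ResolutionOfSingularities.ResolutionOfSingularities.Theorems.EquisingularLiftEquisingularLiftOfSigmaMaxCP2008
import HarnessLib

/-!
# Crux `EquisingularLift` (stmt-ResolutionOfSingularities-15660), line `Sketch` (skeleton v10c `f3e6993bf39ec5c9`):
# the line's assembly with the open residual RE-LOCATED to small characteristic, and the crux from small-characteristic
# blow-up models alone

[OURS · leafhand-res-equisingularlift-6 g1, 2026-08-31] AI-produced, weaker than expert review; NOT a statement of any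
manuscript; nothing here proves resolution of singularities in positive characteristic, and NO registered stub is closed.

With ★★ `blowupModel_largeChar` (p816426: regular blow-up models of integral degree-`d` hypersurfaces of `ℙⁿ_k̄` in characteristic
`p > M(n, d)`) the line's inputs shrink, in its OWN currency, to small characteristic:

* `EquisingularLift_of_sigmaMaxElimination_CP2008_of_smallCharBlowupModels` — **`EquisingularLift` ⟸ CJS Thm. 6.28
  (`CossartJannsenSaito2020_sigmaMaxElimination`) ∧ Cossart–Piltant 2008 Thm. 2.1 (`CP2008.ResolutionQuasiProjectiveThreefolds`) ∧
  «regular blow-up models of the prime-form hypersurfaces `V₊(F) ⊆ ℙⁿ_k̄`, `n ≥ 5`, `deg F = e`, in the finitely many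
  characteristics `p ≤ M(n, e)`»** (`blowupModels_ge_five_of_smallChar` fed into the line's assembly p798346);
* `EquisingularLift_of_smallCharBlowupModels` — **`EquisingularLift` ⟸ «regular blow-up models of the prime-form hypersurfaces of
  `ℙⁿ_k̄` of degree `e` in characteristic `p ≤ M(n, e)`», for all `n` and `e`** (no port at all: `blowupModels_of_smallChar` +
  the linear-centre lift `equisingularLift_of_blowupModels`) — every LARGE-characteristic instance of the line's downstairs
  currency is now a theorem of the tree.

HONEST: `M(n, e) := Classical.choose (blowupModel_largeChar n e)` is ineffective, so no given characteristic is excluded; these are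
re-locations of the residual (what remains is small characteristic, degree by degree), not reductions of its difficulty; the
crux stays summit-equivalent over `k̄`.  `--supports stmt-ResolutionOfSingularities-15660 --as helper`, DEF-FREE, standard axioms,
zero named hypotheses beyond the displayed binders.

References: [CossartJannsenSaito2020, Thm. 6.28, Cor. 6.18]; [CossartPiltant2008, Thm. 2.1]; [Liu2002, Thm. 8.1.24];
[Hartshorne1977, II.7.17].
-/

set_option linter.dupNamespace false -- mandated namespace `Summit.<Summit>.<Problem>` of this single-conjunct summit

noncomputable section

open CategoryTheory AlgebraicGeometry
open Literature.AlgebraicGeometry.Resolution Literature.AlgebraicGeometry.Motives Literature.AlgebraicGeometry.CossartPiltant200819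

namespace Summit.ResolutionOfSingularities.ResolutionOfSingularities.Cruxes.EquisingularLift.StrataSplit

/-- **The line's assembly with its open residual re-located to small characteristic** (CONDITIONAL): `EquisingularLift` from
CJS `Σ^max`-eliminations in dimension `≤ 2`, Cossart–Piltant 2008 for threefolds, and regular blow-up models of the prime-form
hypersurfaces `range ι = V₊(F)` of `ℙⁿ_k̄` (`n ≥ 5`, `deg F = e`, `ι` a closed immersion, `H` integral) in the characteristics
`p ≤ M(n, e) = Classical.choose (blowupModel_largeChar n e)` only. [cite: CossartJannsenSaito2020, Thm. 6.28, Cor. 6.18]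
[cite: CossartPiltant2008, Thm. 2.1] [cite: Liu2002, Thm. 8.1.24] -/
theorem EquisingularLift_of_sigmaMaxElimination_CP2008_of_smallCharBlowupModels
    (hσ : CossartJannsenSaito2020_sigmaMaxElimination.{0}) (h2008 : CP2008.ResolutionQuasiProjectiveThreefolds.{0})
    (hsmall : ∀ (n e p : ℕ), 5 ≤ n → p.Prime → p ≤ Classical.choose (blowupModel_largeChar n e) →
      ∀ (k : Type) [Field k] [CharP k p] [IsAlgClosed k] (H : Scheme.{0}) (ι : H ⟶ (projectiveSpace n k).left)
        (F : MvPolynomial (Fin (n + 1)) k), F.IsHomogeneous e → IsClosedImmersion ι →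
        (IsIntegral H ∧ F ≠ 0 ∧
          letI := MvPolynomial.gradedAlgebra (σ := Fin (n + 1)) (R := k)
          Set.range ι = {x : Proj (MvPolynomial.homogeneousSubmodule (Fin (n + 1)) k) | F ∈ x.asHomogeneousIdeal}) →
        ∃ 𝔞 : H.IdealSheafData, 𝔞 ≠ ⊥ ∧ ∀ (Z : Scheme.{0}) (π : Z ⟶ H), IsBlowup π 𝔞 → Scheme.IsRegular Z) :
    Summit.ResolutionOfSingularities.ResolutionOfSingularities.Theses.EquisingularLift.EquisingularLift :=
  EquisingularLift_of_sigmaMaxElimination_CP2008_of_blowupModels_ge_five hσ h2008 (blowupModels_ge_five_of_smallChar hsmall)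

/-- **`EquisingularLift` from small-characteristic blow-up models alone, every `n`** (no port): if the prime-form hypersurfaces
of `ℙⁿ_k̄` of degree `e` have regular blow-up models in the characteristics `p ≤ M(n, e)` (all `n, e`), then every integral
hypersurface of every `ℙⁿ_k̄` has one (`blowupModels_of_smallChar`: large characteristic is ★★ `blowupModel_largeChar`), and the
crux follows by the linear-centre lift (`equisingularLift_of_blowupModels`, p798346 lineage). [cite: Liu2002, Thm. 8.1.24]
[cite: Hartshorne1977, II.7.17] -/
theorem EquisingularLift_of_smallCharBlowupModels
    (hsmall : ∀ (n e p : ℕ), p.Prime → p ≤ Classical.choose (blowupModel_largeChar n e) →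
      ∀ (k : Type) [Field k] [CharP k p] [IsAlgClosed k] (H : Scheme.{0}) (ι : H ⟶ (projectiveSpace n k).left)
        (F : MvPolynomial (Fin (n + 1)) k), F.IsHomogeneous e → IsClosedImmersion ι →
        (IsIntegral H ∧ F ≠ 0 ∧
          letI := MvPolynomial.gradedAlgebra (σ := Fin (n + 1)) (R := k)
          Set.range ι = {x : Proj (MvPolynomial.homogeneousSubmodule (Fin (n + 1)) k) | F ∈ x.asHomogeneousIdeal}) →
        ∃ 𝔞 : H.IdealSheafData, 𝔞 ≠ ⊥ ∧ ∀ (Z : Scheme.{0}) (π : Z ⟶ H), IsBlowup π 𝔞 → Scheme.IsRegular Z) :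
    Summit.ResolutionOfSingularities.ResolutionOfSingularities.Theses.EquisingularLift.EquisingularLift :=
  equisingularLift_of_blowupModels fun p hp k _ _ _ n H ι hι hH hloc _ =>
    blowupModels_of_smallChar hsmall p hp k n H ι hι hH hloc

end Summit.ResolutionOfSingularities.ResolutionOfSingularities.Cruxes.EquisingularLift.StrataSplit

end
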